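import Summits.HodgeConjecture.HodgeConjecture.Theorems.Q8SymplecticPowersRegularOfOneFibre
import Summits.HodgeConjecture.HodgeConjecture.Theorems.Q8SymplecticPowersFamilyDeckHolds
import HarnessLib

/-!
# Route `Q8SymplecticPowers`, crux K1Q (stmt-HodgeConjecture-24190), line `mechanism-v2`: stub S1 `stub_regularVeryGeneralQ`
# REDUCED TO ONE FIBRE — now WITHOUT the Kollár binder

HELPER FILE (`--supports stmt-HodgeConjecture-24190 --as helper`; nothing here closes an item). The tree's
`Q8SymplecticPowersRegularOfOneFibre.stub_regularVeryGeneralQ_of_oneFibre hK HQ : <S1 verbatim>` (prover-Bx g20) took the named fact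
`Kollar2007_resolutionLiftsAutomorphisms` (`hK`) only to obtain the S6 deck family. That family now exists unconditionally
(`Q8SymplecticPowersFamilyDeckHolds.stub_familyDeckExistsQ_holds`, leafhand-4 g3: equivariant immersion of the generic étale chart into
`ℙⁿ_K` with a linear `Q₈`-action + the tree's proved equivariant strong resolution), so the reduction holds with `HQ` ALONE:

* `stub_regularVeryGeneralQ_of_oneFibre_kollarFree HQ : <S1 verbatim>` — proof = the g20 proof verbatim with the family taken from
  `stub_familyDeckExistsQ_holds` (path-connected base ⇒ `b₁` constant (Ehresmann); genericity polynomials; birational invariance of `b₁`).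

So the residue of S1 is literally ONE number per even `e ≥ 4` — `b₁ = 0` for one fibre of the deck family — with no named fact.
Honest scope: a reduction; S1, K1Q, HC are NOT proved here.

References: R. Hartshorne, *Algebraic Geometry*, II Ex. 8.8, V Rem. 5.6.1; C. Voisin, *Hodge Theory I*, §9.1.1 Thm. 9.3.
-/

set_option linter.dupNamespace false

noncomputable section

open CategoryTheory AlgebraicGeometry MonoidalCategory CartesianMonoidalCategory
open Literature.AlgebraicGeometry Literature.AlgebraicGeometry.Motives Literature.AlgebraicGeometry.HodgeTheory
open Literature.AlgebraicGeometry.HodgeTheory.BettiUniverse Literature.AlgebraicGeometry.HodgeTheory.Q8Family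
open Literature.AlgebraicGeometry.RelativeSpec Literature.AlgebraicGeometry.RelativeSpec.ActionOver

namespace Summit.HodgeConjecture.HodgeConjecture.Theorems.Q8SymplecticPowersRegularOfOneFibreKollarFree

/-- **S1 reduced to one fibre, Kollár-free.** Granted ONLY
`HQ` : for every even `e ≥ 4` and every deck-family package of S6 (same binders as S4∕S5), SOME fibre has `b₁ = 0` — the registered
statement of S1 holds: very generally every smooth projective `X` birational over `ℂ` to `V_(c,ψ)` has `b₁(X) = 0` (module docstring).
[cite: Hartshorne1977, II Ex. 8.8 and V Remark 5.6.1] [cite: VoisinHodgeI2002, §9.1.1 Thm. 9.3] [cite: Kollar2007, Thm. 3.36] -/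
theorem stub_regularVeryGeneralQ_of_oneFibre_kollarFree
    (HQ :     open Literature.AlgebraicGeometry.Motives Literature.AlgebraicGeometry.HodgeTheory Literature.AlgebraicGeometry.HodgeTheory.BettiUniverse Literature.AlgebraicGeometry.HodgeTheory.Q8Family Literature.AlgebraicGeometry.RelativeSpec Literature.AlgebraicGeometry.RelativeSpec.ActionOver Literature.Algebra.Lie Literature.Algebra.Lie.KatzRecognition CategoryTheory CategoryTheory.Limits MonoidalCategory CartesianMonoidalCategory AlgebraicGeometry in ∀ ⦃e : ℕ⦄, Even e → 4 ≤ e → ∀ (W : (Spec (.of (ParamRing e))).Opens) (𝒳 : SchemeOver ℂ) (π : 𝒳 ⟶ base W) (τ j : 𝒳 ⟶ 𝒳) (ι : (deckChart (fun i => (MvPolynomial.X i : ParamRing e)) ⊗ Over.mk W.ι).left ⟶ 𝒳.left), Nonempty (ComplexPoints (base W)) → ∀ (hπ : IsSmoothProjectiveFamily π 2), IsQuasiProjectiveOver 𝒳 → IsQuasiProjectiveOver (base W) → AlgebraicGeometry.SmoothOfRelativeDimension (Fintype.card (CIdx e)) (base W).hom → ∀ (hτπ : τ ≫ π = π) (hjπ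 : j ≫ π = π), τ ≫ τ ≫ τ ≫ τ = 𝟙 𝒳 → j ≫ j = τ ≫ τ → τ ≫ j ≫ τ = j → IsOpenImmersion ι → ι ≫ π.left = (snd (deckChart (fun i => (MvPolynomial.X i : ParamRing e))) (Over.mk W.ι)).left → ((Over.isoMk ((deckAction (fun i => (MvPolynomial.X i : ParamRing e))).aut (QuaternionGroup.a 1)) ((deckAction (fun i => (MvPolynomial.X i : ParamRing e))).aut_comp (QuaternionGroup.a 1))).hom ▷ Over.mk W.ι).left ≫ ι = ι ≫ τ.left → ((Over.isoMk ((deckAction (fun i => (MvPolynomial.X i : ParamRing e))).aut (QuaternionGroup.xa 0)) ((deckAction (fun i => (MvPolynomial.X i : ParamRing e))).aut_comp (QuaternionGroup.xa 0))).hom ▷ Over.mk W.ι).left ≫ ι = ι ≫ j.left → Function.Surjective (snd (deckChart (fun i => (MvPolynomial.X i : ParamRing e))) (Over.mk W.ι)).left → ∃ a₀ : ComplexPoints (base W), Module.finrank ℚ (bettiCohomology (fiberOver π a₀) 1) = 0) :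
open Literature.AlgebraicGeometry.Motives Literature.AlgebraicGeometry.HodgeTheory Literature.AlgebraicGeometry.HodgeTheory.BettiUniverse CategoryTheory.Limits in ∀ ⦃e : ℕ⦄, Even e → 4 ≤ e → ∃ G : ℕ → MvPolynomial ({d : Fin 3 →₀ ℕ // d.degree = 1} ⊕ {d : Fin 3 →₀ ℕ // d.degree = e - 1}) ℂ, (∀ i, ∃ c ψ : MvPolynomial (Fin 3) ℂ, c.IsHomogeneous 1 ∧ ψ.IsHomogeneous (e - 1) ∧ MvPolynomial.rename (Equiv.swap (0 : Fin 3) 1) ψ = ψ ∧ MvPolynomial.eval (Sum.elim (fun d => c.coeff d.1) (fun d => ψ.coeff d.1)) (G i) ≠ 0) ∧ ∀ c ψ : MvPolynomial (Fin 3) ℂ, c.IsHomogeneous 1 → ψ.IsHomogeneous (e - 1) → MvPolynomial.rename (Equiv.swap (0 : Fin 3) 1) ψ = ψ → (∀ i, MvPolynomial.eval (Sum.elim (fun d => c.coeff d.1) (fun d => ψ.coeff d.1)) (G i) ≠ 0) → ∀ ⦃V X : SchemeOver ℂ⦄ (hX : IsSmoothProjective 2 X), IsHypersurfaceCutOutBy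 3 (MvPolynomial.X (Fin.last 3) ^ 4 * MvPolynomial.X (Fin.castSucc 2) ^ (2 * e) - MvPolynomial.rename Fin.castSucc (c * MvPolynomial.rename (Equiv.swap (0 : Fin 3) 1) c ^ 3 * ((MvPolynomial.X 0 - MvPolynomial.X 1) * ψ) ^ 2)) V → AlgebraicGeometry.Scheme.BirationalOver X.hom V.hom → Module.finrank ℚ (bettiCohomology X 1) = 0 := by
  intro e he h4
  obtain ⟨W, 𝒳, π, τ, j, ι, hne, hπ, hqp, hqpW, hsm, ⟨hτπ, hjπ, hτ4, hj2, hτjτ⟩, hιo, hιπ, hιτ, hιj, hsurj⟩ :=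
    Q8SymplecticPowersFamilyDeckHolds.stub_familyDeckExistsQ_holds he h4
  obtain ⟨a₀, ha₀⟩ := HQ he h4 W 𝒳 π τ j ι hne hπ hqp hqpW hsm hτπ hjπ hτ4 hj2 hτjτ hιo hιπ hιτ hιj hsurj
  haveI := hsm
  haveI : PathConnectedSpace (ComplexPoints (base W)) := Q8SymplecticPowersRegularOfOneFibre.pathConnectedSpace_complexPoints_base (m := Fintype.card (CIdx e)) W hne
  -- the genericity polynomials, with no bad set
  have hBad : ∀ j : ℕ, IsZariskiClosedOnPoints (base W) ((fun _ : ℕ => (∅ : Set (ComplexPoints (base W)))) j) ∧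
      (fun _ : ℕ => (∅ : Set (ComplexPoints (base W)))) j ≠ Set.univ := by
    intro j'
    refine ⟨⟨∅, isClosed_empty, by ext P; simp⟩, ?_⟩
    obtain ⟨t₀⟩ := hne
    intro h
    have ht₀ : t₀ ∈ (Set.univ : Set (ComplexPoints (base W))) := Set.mem_univ _
    rw [← h] at ht₀
    exact ht₀
  obtain ⟨G, hGne, hGpt⟩ := Q8SymplecticPowersGenericityPolynomials.exists_genericityPolynomials W hne (fun _ => ∅) hBad
    (genericityElem e) (genericityElem_ne_zero e (by omega))
  refine ⟨G, hGne, ?_⟩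
  intro c ψ hc hψ hψσ hGi V X hX hV hbir
  obtain ⟨t, htc, htψ, -, hGe⟩ := hGpt c ψ hc hψ hψσ hGi
  -- the fibre over `t` is birational to `V_(c,ψ)` (G8), hence to `X`
  have hbV := Q8SymplecticPowersFibreBirational.birationalOver_fiberOver_of_deckClauses (by omega) W 𝒳 π ι hπ hιo hιπ hsurj t hGe
    (V := V) (by rw [htc, htψ]; exact hV)
  rw [finrank_bettiCohomology_one_eq_of_birationalOver hX (hπ.isSmoothProjective t) (hbir.trans hbV.symm),
    finrank_bettiCohomology_fiberOver_eq_of_joined π hπ hqpW (d := Fintype.card (CIdx e)) (PathConnectedSpace.joined t a₀) 1]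
  exact ha₀

end Summit.HodgeConjecture.HodgeConjecture.Theorems.Q8SymplecticPowersRegularOfOneFibreKollarFree

end
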